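import Summits.RiemannHypothesis.RiemannHypothesis.Theorems.GroundBartaEvenWinsBeyondArchPhantomCertificate
import HarnessLib

/-!
# RiemannHypothesis / GroundBarta machinery — PHANTOM CERTIFICATES: `κ` from chain FACTS (kernel glue)

Helper file (`--supports stmt-RiemannHypothesis-18085`; format A′ infrastructure), RH-free, axioms standard.  Seat
rh-explicit-weil-1.  `WeilCert23X.kappaExact` reads the phantom chain through `xCellsBndMaxQ c.xcells` and
`xCellsAbsMomentQ c.xcells (N+1)`, which a single `decide` cannot evaluate on a 240-cell chain through the landed (slow-binomial)
`XTCell.absQ` (rh-explicit-weil-6's heads-up, 2026-08-22).  This file lets a certificate's κ / scalar check be discharged from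
two landed FACTS about the chain (e.g. `xt120_bndMaxQ`, `xt120_absMomentQ_272` of `…PhantomXT120Kappa`, proved there via the
fast twins of `…LatticeRippleTFast`):

* `WeilCert23X.kappaExactWith c B M` — `κ_exact` with the two chain quantities replaced by rationals `B`, `M`;
* `kappaExact_eq_of_facts`, `kappaQ_eq_of_facts`, **`checkScalars_of_facts`**:
  `checkScalars_of_facts hB hM (by decide +kernel) : c.checkScalars = true`.
Everything here is proved; no named facts.
-/

set_option linter.dupNamespace false

noncomputable section

namespace Summit.RiemannHypothesis.RiemannHypothesis.Theorems.EvenWinsBeyondArch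

open Literature.NumberTheory.LFunctions
open Literature.Analysis.ValidatedNumerics.Numerics
open Literature.Analysis.SpecialFunctions

namespace WeilCert23X

variable (c : WeilCert23X)

/-- `κ_exact` with `xCellsBndMaxQ c.xcells := B` and `xCellsAbsMomentQ c.xcells (N+1) := M` substituted. [folklore] -/
def kappaExactWith (B M : ℚ) : ℚ :=
  c.wL - logPiHi20 - 7 * (invTwoPiHi20 - invTwoPiLo20) * (cellsBndMaxQ₂₃ c.base.wL c.cells + |c.wL - c.base.wL| + B) -
    2 * c.base.a0 * (c.base.etaP + 5 * invTwoPiHi20 *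
      (2 * (c.base.a0 ^ (c.base.N + 1) * (2 * (cellsAbsMomentQ₂₃ c.base.wL c.cells (c.base.N + 1) +
        |c.wL - c.base.wL| * (c.base.T ^ (c.base.N + 1 + 1) / ((c.base.N + 1 : ℕ) + 1)) + M))) / (c.base.N + 1).factorial) +
      ((c.base.N : ℚ) + 1) ^ 2 * (1 / 2 ^ c.base.pg + invTwoPiHi / 2 ^ c.pnu))

variable {c}

/-- `κ_exact` from the two chain facts. [folklore] -/
theorem kappaExact_eq_of_facts {B M : ℚ} (hB : xCellsBndMaxQ c.xcells = B)
    (hM : xCellsAbsMomentQ c.xcells (c.base.N + 1) = M) : c.kappaExact = c.kappaExactWith B M := by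
  subst hB hM
  rfl

/-- `κ = rd(κ_exact)` from the two chain facts. [folklore] -/
theorem kappaQ_eq_of_facts {B M : ℚ} (hB : xCellsBndMaxQ c.xcells = B)
    (hM : xCellsAbsMomentQ c.xcells (c.base.N + 1) = M) : c.kappaQ = ratRd c.base.pg (c.kappaExactWith B M) := by
  rw [kappaQ, kappaExact_eq_of_facts hB hM]

/-- **The scalar check from the two chain facts** and one small kernel decision. [folklore] -/
theorem checkScalars_of_facts {B M : ℚ} (hB : xCellsBndMaxQ c.xcells = B)
    (hM : xCellsAbsMomentQ c.xcells (c.base.N + 1) = M)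
    (h : (decide (1 ≤ c.j) && decide (0 < c.b) && decide (c.b ≤ c.base.a0) && decide (c.base.a0 ≤ 1) &&
      decide (0 < c.base.T) && decide (2 * c.base.a0 * c.base.T ≤ (c.base.N : ℚ) + 2) &&
      decide (2 * (c.base.a0 * c.base.T) ^ (c.base.N + 1) / (c.base.N + 1).factorial ≤ 1) &&
      decide (c.base.N + 1 = 2 * c.base.nb) && decide (0 ≤ ratRd c.base.pg (c.kappaExactWith B M))) = true) :
    c.checkScalars = true := by
  unfold checkScalars
  rw [kappaQ_eq_of_facts hB hM]
  exact h

/-- A lower bound `κ₀ ≤ κ` from the two chain facts and one small kernel decision (for `β ≤ κ` checks). [folklore] -/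
theorem le_kappaQ_of_facts {B M κ₀ : ℚ} (hB : xCellsBndMaxQ c.xcells = B)
    (hM : xCellsAbsMomentQ c.xcells (c.base.N + 1) = M) (h : decide (κ₀ ≤ ratRd c.base.pg (c.kappaExactWith B M)) = true) :
    κ₀ ≤ c.kappaQ := by
  rw [kappaQ_eq_of_facts hB hM]
  exact of_decide_eq_true h

end WeilCert23X

end Summit.RiemannHypothesis.RiemannHypothesis.Theorems.EvenWinsBeyondArch

end
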